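import Summits.AtomisticToContinuum.Crystallization.Theorems.FrustratedLawDichotomyStrainedPatchHomEntryFitHcpConeLeaf
import Summits.AtomisticToContinuum.Crystallization.Theorems.FrustratedLawDichotomyStrainedPatchHomEntryFitCentred

/-!
# SHARP-COLLAR editions of the fat leaf and the cone leaf: the ξ-collar read ENTRYWISE from the cell's own `U`-box
# (reach ×1.25 at zero kernel cost; critic row 1531/1536 «κS refinement of the fat leaf's strain factor», done one better)

decomp-a2c hand-2 g41 — structural share for the crux `AperiodicFrustratedLawGap` (stmt-AtomisticToContinuum-27623; `(H) HomFloor`, hcp half),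
on top of #25 `…EntryFitHcpFatLeaf` (p854329/p854340) and #26 `…EntryFitHcpConeLeaf` (p854423).

THE POINT.  Both leaves certify a cell `(c, w)` from ONE thin robust certificate `fitOKHDCRSρ c₀ w₀ q ρS e0S` provided the shuffle `ξ'` of the cell
is within `‖U'(ξ' − ξ)‖ ≤ s·ρ` of a thin shuffle `ξ` (`hcpLeafGoal_of_collar` / `_of_cone_collar`).  #25/#26 bound `‖U'δ‖ ≤ (1 + ‖U' − 1‖)·‖δ‖ ≤
(5/4)·‖δ‖` through the WINDOW `‖U' − 1‖ ≤ 1/4` — the factor `5/4` is paid on every cell although a census cell has `‖U' − 1‖ ≈ 0.07` and, worse,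
`‖δ‖` is the Euclidean norm of the three collar excesses.  Here `‖U'δ‖` is read ENTRYWISE from the cell's own nine `U`-intervals
(`…EntryFitCentred.apply_coord_eq_sum`): `|(U'δ)_a| ≤ Σ_b (|c_ab| + w_ab)·Δ_b / SC²`, so

  `‖U'(ξ' − ξ)‖ ≤ √(Σ_a (Σ_b (|c_ab| + w_ab)·Δ_b)²) / SC²`     (★ `norm_apply_le_sqrt_of_entry_box`, generic)

and the integer test becomes `sD²·Σ_a (Σ_b (|c_ab| + w_ab)·Δ_b)² ≤ sN²·ρS²·SC²` (`xiCollarSharpOK`).  For a census-size cell (`w ≈ 2⁻⁸·SC`, `U ≈ 1`)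
this is `≈ ‖Δ‖ ≤ s·ρ` instead of `(5/4)‖Δ‖ ≤ s·ρ`: collar REACH ×1.25 per coordinate (ξ-volume per thin certificate ×1.95) at the cost of a few
integer multiplications per cell.  For WIDE cells the window bound can be better, so the cell tests take the DISJUNCTION
`xiCollarEitherOK := xiConeCollarOK || xiCollarSharpOK` — every cell admitted by #25/#26 is still admitted (`…_of_cone`, `…_of_fat` below).

§1 the generic estimate + the coordinatewise clamp; §2 the tests `xiCollarSharpOK`, `xiCollarEitherOK`, `fat{Cell,Leaf,Leaves}SharpOK` (s = 1, NO dilation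
test; via `hcpLeafGoal_of_collar`), `cone{Cell,Leaf,Leaves}SharpOK` (via `hcpLeafGoal_of_cone_collar`); §3 soundness `semOKHQ_of_{fat,cone}LeafSharpOK` + list
editions (thin certificate evaluated ONCE); §4 containment `fatCellOK → fatCellSharpOK`, `coneCellOK → coneCellSharpOK` (nothing admitted before is lost).

NO new analytic input (one Cauchy-free coordinate estimate + bookkeeping over landed theorems); 0 sorry; standard axioms; no instances / notation / `#eval`.
`--supports stmt-AtomisticToContinuum-27623`.
-/

noncomputable section

namespace Summit.AtomisticToContinuum.Crystallization.Theorems.FrustratedLawDichotomyStrainedPatchHomEntryFitHcpSharpCollar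

open scoped BigOperators RealInnerProductSpace
open Literature.Analysis.ValidatedNumerics.Numerics
open Summit.AtomisticToContinuum.Crystallization.Theorems.ChargedEnergyGapNegative (E3)
open Summit.AtomisticToContinuum.Crystallization.Theorems.FrustratedLawDichotomyStrainedPatchHomEntryHcpFrame
open Summit.AtomisticToContinuum.Crystallization.Theorems.FrustratedLawDichotomyStrainedPatchHomEntryLeafHT (HcpLeafGoal)
open Summit.AtomisticToContinuum.Crystallization.Theorems.FrustratedLawDichotomyStrainedPatchHomParamTransfer (HcpFitCoreRobust hcpLeafGoal_of_collar
  hcpLeafGoal_of_cone_collar norm_sq_eq_sum_coord_sq norm_apply_le_of_coord_sq smul_clm_apply)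
open Summit.AtomisticToContinuum.Crystallization.Theorems.FrustratedLawDichotomyStrainedPatchHomEntryFitCentred (apply_coord_eq_sum)
open Summit.AtomisticToContinuum.Crystallization.Theorems.FrustratedLawDichotomyStrainedPatchHomEntryFitHcpKit (dEnclH)
open Summit.AtomisticToContinuum.Crystallization.Theorems.FrustratedLawDichotomyStrainedPatchHomEntryFitHcpCentred (fitOKHDCRSρ fitOKHDCRSρ_sound)
open Summit.AtomisticToContinuum.Crystallization.Theorems.FrustratedLawDichotomyStrainedPatchHomEntrySemanticQuot (semOKHQ semOKHQ_of_sound)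
open Summit.AtomisticToContinuum.Crystallization.Theorems.FrustratedLawDichotomyStrainedPatchHomEntryFitHcpFatLeaf (uContained xiDelta xiCollarOK fatCellOK
  clamp_spec uContained_spec abs_le_of_contained xiCollarOK_spec)
open Summit.AtomisticToContinuum.Crystallization.Theorems.FrustratedLawDichotomyStrainedPatchHomEntryFitHcpConeLeaf (uConeContained xiConeCollarOK coneDilationOK
  coneCellOK uConeContained_spec coneDilationOK_spec xiConeCollarOK_spec abs_le_of_coneContained selfAdjoint_smul smul_entry uConeContained_one_one
  xiConeCollarOK_one_one)

/-! ## §1. The generic entrywise estimate and the coordinatewise clamp -/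

/-- One coordinate of `U δ` from an entry box and a coordinate box: `|(U δ)_a| ≤ Σ_b M_ab·Δ_b`. [arithmetic over `apply_coord_eq_sum`] -/
theorem abs_apply_coord_le {U : E3 →L[ℝ] E3} {δ : E3} {M : Fin 3 → Fin 3 → ℝ} {Δ : Fin 3 → ℝ}
    (hM : ∀ a b : Fin 3, |(U (EuclideanSpace.single b (1 : ℝ))) a| ≤ M a b) (hΔ : ∀ b : Fin 3, |δ b| ≤ Δ b) (a : Fin 3) :
    |(U δ) a| ≤ ∑ b : Fin 3, M a b * Δ b := by
  rw [apply_coord_eq_sum]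
  refine (Finset.abs_sum_le_sum_abs _ _).trans (Finset.sum_le_sum fun b _ => ?_)
  rw [abs_mul, mul_comm]
  exact mul_le_mul (hM a b) (hΔ b) (abs_nonneg _) ((abs_nonneg _).trans (hM a b))

/-- ★ **ENTRY BOX × COORDINATE BOX ⟹ NORM**: `‖U δ‖ ≤ √(Σ_a (Σ_b M_ab·Δ_b)²)`. [folklore] -/
theorem norm_apply_le_sqrt_of_entry_box {U : E3 →L[ℝ] E3} {δ : E3} {M : Fin 3 → Fin 3 → ℝ} {Δ : Fin 3 → ℝ}
    (hM : ∀ a b : Fin 3, |(U (EuclideanSpace.single b (1 : ℝ))) a| ≤ M a b) (hΔ : ∀ b : Fin 3, |δ b| ≤ Δ b) :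
    ‖U δ‖ ≤ Real.sqrt (∑ a : Fin 3, (∑ b : Fin 3, M a b * Δ b) ^ 2) := by
  have h1 : ‖U δ‖ ^ 2 ≤ ∑ a : Fin 3, (∑ b : Fin 3, M a b * Δ b) ^ 2 := by
    rw [norm_sq_eq_sum_coord_sq]
    refine Finset.sum_le_sum fun a _ => ?_
    have h := abs_apply_coord_le hM hΔ a
    exact sq_le_sq' (by linarith [(abs_le.1 h).1]) (abs_le.1 h).2
  calc ‖U δ‖ = Real.sqrt (‖U δ‖ ^ 2) := (Real.sqrt_sq (norm_nonneg _)).symm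
    _ ≤ _ := Real.sqrt_le_sqrt h1

/-- An entry interval bounds the entry's size: `|x − c/SC| ≤ w/SC ⟹ |x| ≤ (|c| + w)/SC`. [arithmetic] -/
theorem abs_le_of_entry_box {x : ℝ} {c w : ℤ} (hx : |x - (c : ℝ) / SC| ≤ (w : ℝ) / SC) : |x| ≤ ((|c| + w : ℤ) : ℝ) / SC := by
  have hS : (0 : ℝ) < SC := SC_pos
  have h1 : |x| - |(c : ℝ) / SC| ≤ (w : ℝ) / SC := (abs_sub_abs_le_abs_sub _ _).trans hx
  have h2 : |(c : ℝ) / SC| = |(c : ℝ)| / SC := by rw [abs_div, abs_of_pos hS]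
  have h3 : |x| ≤ |(c : ℝ)| / SC + (w : ℝ) / SC := by linarith
  push_cast [add_div]
  exact h3

/-- ★ **THE CLAMP, COORDINATEWISE** (the fat leaf's `clamp_spec`, packaged with per-coordinate excesses): for `ξ'` in the cell's shuffle box and
nonnegative thin shuffle half-widths, the clamp `ξ` lies in the thin shuffle box and `|ξ'ᵢ − ξᵢ| ≤ Δᵢ/SC` for every `i`. [arithmetic] -/
theorem exists_clamp_near_coord {c₀ w₀ c w : (Fin 3 × Fin 3) ⊕ Fin 3 → ℤ} (hw₀ : ∀ i : Fin 3, (0 : ℤ) ≤ w₀ (Sum.inr i)) {ξ' : E3}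
    (hξb : ∀ i : Fin 3, |ξ' i - (c (Sum.inr i) : ℝ) / SC| ≤ (w (Sum.inr i) : ℝ) / SC) :
    ∃ ξ : E3, (∀ i : Fin 3, |ξ i - (c₀ (Sum.inr i) : ℝ) / SC| ≤ (w₀ (Sum.inr i) : ℝ) / SC) ∧
      ∀ i : Fin 3, |(ξ' - ξ) i| ≤ ((xiDelta c₀ w₀ c w i : ℤ) : ℝ) / SC := by
  have hS : (0 : ℝ) < SC := SC_pos
  set t : Fin 3 → ℝ := fun i =>
    max ((c₀ (Sum.inr i) : ℝ) / SC - (w₀ (Sum.inr i) : ℝ) / SC)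
      (min ((c₀ (Sum.inr i) : ℝ) / SC + (w₀ (Sum.inr i) : ℝ) / SC) (ξ' i)) with ht
  set ξ : E3 := (EuclideanSpace.equiv (Fin 3) ℝ).symm t with hξdef
  have hξi : ∀ i : Fin 3, ξ i = t i := fun i => rfl
  refine ⟨ξ, fun i => ?_, fun i => ?_⟩
  · have hw₀' : (0 : ℝ) ≤ (w₀ (Sum.inr i) : ℝ) / SC := div_nonneg (by exact_mod_cast hw₀ i) hS.le
    rw [hξi i]
    exact (clamp_spec (c₀ := (c₀ (Sum.inr i) : ℝ) / SC) (hξb i) hw₀').1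
  · have hw₀' : (0 : ℝ) ≤ (w₀ (Sum.inr i) : ℝ) / SC := div_nonneg (by exact_mod_cast hw₀ i) hS.le
    have hcs := (clamp_spec (c₀ := (c₀ (Sum.inr i) : ℝ) / SC) (hξb i) hw₀').2
    have e : (ξ' - ξ) i = ξ' i - t i := by rw [← hξi i]; rfl
    rw [e]
    refine hcs.trans (max_le ?_ ?_)
    · exact div_nonneg (by exact_mod_cast (le_max_left 0 _ : (0 : ℤ) ≤ xiDelta c₀ w₀ c w i)) hS.le
    · have hD1 : (|(c (Sum.inr i) : ℝ) - c₀ (Sum.inr i)| + w (Sum.inr i) - w₀ (Sum.inr i) : ℝ) ≤ ((xiDelta c₀ w₀ c w i : ℤ) : ℝ) := by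
        have := (le_max_right 0 _ : |c (Sum.inr i) - c₀ (Sum.inr i)| + w (Sum.inr i) - w₀ (Sum.inr i) ≤ xiDelta c₀ w₀ c w i)
        have := (Int.cast_le (R := ℝ)).2 this
        push_cast [xiDelta] at this ⊢
        exact this
      have := div_le_div_of_nonneg_right hD1 hS.le
      calc |(c (Sum.inr i) : ℝ) / SC - (c₀ (Sum.inr i) : ℝ) / SC| + (w (Sum.inr i) : ℝ) / SC - (w₀ (Sum.inr i) : ℝ) / SC
          = (|(c (Sum.inr i) : ℝ) - c₀ (Sum.inr i)| + w (Sum.inr i) - w₀ (Sum.inr i)) / SC := by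
            rw [← sub_div, abs_div, abs_of_pos hS]; ring
        _ ≤ _ := this

/-! ## §2. The Boolean tests -/

/-- The entry magnitude bound of the cell's `U`-box: `M_ab := |c_ab| + w_ab` (scale `SC`). -/
def entryMag (c w : (Fin 3 × Fin 3) ⊕ Fin 3 → ℤ) (a b : Fin 3) : ℤ := |c (Sum.inl (a, b))| + w (Sum.inl (a, b))

/-- The sharp collar functional `Σ_a (Σ_b M_ab·Δ_b)²` (scale `SC⁴`). -/
def collarSharpSum (c₀ w₀ c w : (Fin 3 × Fin 3) ⊕ Fin 3 → ℤ) : ℤ :=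
  ∑ a : Fin 3, (∑ b : Fin 3, entryMag c w a b * xiDelta c₀ w₀ c w b) ^ 2

/-- ★ (ii♯) the SHARP dilated ξ-collar test at `s = sN/sD`: thin shuffle half-widths `≥ 0` and `sD²·Σ_a (Σ_b M_ab·Δ_b)² ≤ sN²·ρS²·SC²`
(i.e. `√(Σ_a (Σ_b M_ab Δ_b)²)/SC² ≤ s·ρS/SC`). -/
def xiCollarSharpOK (sN sD : ℤ) (c₀ w₀ : (Fin 3 × Fin 3) ⊕ Fin 3 → ℤ) (ρS : ℤ) (c w : (Fin 3 × Fin 3) ⊕ Fin 3 → ℤ) : Bool :=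
  ((List.finRange 3).all fun i => decide (0 ≤ w₀ (Sum.inr i))) &&
    decide (sD ^ 2 * collarSharpSum c₀ w₀ c w ≤ sN ^ 2 * ρS ^ 2 * SC ^ 2)

/-- (ii∨) EITHER collar test: the window-based one of #25/#26 OR the sharp entrywise one. -/
def xiCollarEitherOK (sN sD : ℤ) (c₀ w₀ : (Fin 3 × Fin 3) ⊕ Fin 3 → ℤ) (ρS : ℤ) (c w : (Fin 3 × Fin 3) ⊕ Fin 3 → ℤ) : Bool :=
  xiConeCollarOK sN sD c₀ w₀ ρS c w || xiCollarSharpOK sN sD c₀ w₀ ρS c w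

/-- The cheap FAT cell test, sharp edition (`s = 1`, no dilation test): `U`-containment ∧ either collar. -/
def fatCellSharpOK (c₀ w₀ : (Fin 3 × Fin 3) ⊕ Fin 3 → ℤ) (ρS : ℤ) (c w : (Fin 3 × Fin 3) ⊕ Fin 3 → ℤ) : Bool :=
  uContained c₀ w₀ c w && xiCollarEitherOK 1 1 c₀ w₀ ρS c w

/-- ★ The FAT LEAF, sharp edition. -/
def fatLeafSharpOK (c₀ w₀ : (Fin 3 × Fin 3) ⊕ Fin 3 → ℤ) (q : Fin 4 → ℤ) (ρS e0S : ℤ) (c w : (Fin 3 × Fin 3) ⊕ Fin 3 → ℤ) : Bool :=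
  fatCellSharpOK c₀ w₀ ρS c w && fitOKHDCRSρ c₀ w₀ q ρS e0S

/-- ONE thin certificate + a LIST of sharp fat cells. -/
def fatLeavesSharpOK (c₀ w₀ : (Fin 3 × Fin 3) ⊕ Fin 3 → ℤ) (q : Fin 4 → ℤ) (ρS e0S : ℤ)
    (L : List (((Fin 3 × Fin 3) ⊕ Fin 3 → ℤ) × ((Fin 3 × Fin 3) ⊕ Fin 3 → ℤ))) : Bool :=
  fitOKHDCRSρ c₀ w₀ q ρS e0S && L.all fun b => fatCellSharpOK c₀ w₀ ρS b.1 b.2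

/-- The cheap CONE cell test, sharp edition: dilation range ∧ cone `U`-containment ∧ either collar. -/
def coneCellSharpOK (c₀ w₀ : (Fin 3 × Fin 3) ⊕ Fin 3 → ℤ) (ρS hi sN sD : ℤ) (c w : (Fin 3 × Fin 3) ⊕ Fin 3 → ℤ) : Bool :=
  coneDilationOK sN sD hi ρS && uConeContained sN sD c₀ w₀ c w && xiCollarEitherOK sN sD c₀ w₀ ρS c w

/-- ★ The CONE LEAF, sharp edition. -/
def coneLeafSharpOK (c₀ w₀ : (Fin 3 × Fin 3) ⊕ Fin 3 → ℤ) (q : Fin 4 → ℤ) (ρS e0S sN sD : ℤ) (c w : (Fin 3 × Fin 3) ⊕ Fin 3 → ℤ) : Bool :=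
  coneCellSharpOK c₀ w₀ ρS (dEnclH c₀ w₀).hi sN sD c w && fitOKHDCRSρ c₀ w₀ q ρS e0S

/-- ONE thin certificate + a LIST of sharp cone cells `(sN, sD, c, w)` (`dEnclH` computed once). -/
def coneLeavesSharpOK (c₀ w₀ : (Fin 3 × Fin 3) ⊕ Fin 3 → ℤ) (q : Fin 4 → ℤ) (ρS e0S : ℤ)
    (L : List (ℤ × ℤ × ((Fin 3 × Fin 3) ⊕ Fin 3 → ℤ) × ((Fin 3 × Fin 3) ⊕ Fin 3 → ℤ))) : Bool :=
  let hi := (dEnclH c₀ w₀).hi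
  fitOKHDCRSρ c₀ w₀ q ρS e0S && L.all fun b => coneCellSharpOK c₀ w₀ ρS hi b.1 b.2.1 b.2.2.1 b.2.2.2

/-! ## §3. Soundness -/

/-- Reading `xiCollarSharpOK` over the reals. [formal bookkeeping] -/
theorem xiCollarSharpOK_spec {sN sD : ℤ} {c₀ w₀ c w : (Fin 3 × Fin 3) ⊕ Fin 3 → ℤ} {ρS : ℤ} (h : xiCollarSharpOK sN sD c₀ w₀ ρS c w = true) :
    (∀ i : Fin 3, (0 : ℤ) ≤ w₀ (Sum.inr i)) ∧
      ((sD : ℤ) : ℝ) ^ 2 * ∑ a : Fin 3, (∑ b : Fin 3, ((entryMag c w a b : ℤ) : ℝ) * ((xiDelta c₀ w₀ c w b : ℤ) : ℝ)) ^ 2 ≤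
        ((sN : ℤ) : ℝ) ^ 2 * ((ρS : ℤ) : ℝ) ^ 2 * (SC : ℝ) ^ 2 := by
  simp only [xiCollarSharpOK, List.all_eq_true, List.mem_finRange, true_implies, Bool.and_eq_true, decide_eq_true_eq] at h
  refine ⟨h.1, ?_⟩
  have := (Int.cast_le (R := ℝ)).2 h.2
  push_cast [collarSharpSum] at this
  exact this

/-- ★ **THE SHARP COLLAR BOUND**: for the ACTUAL operator `U'` in the cell's `U`-box and the clamp `ξ` of `ξ'`, the sharp test at `s = sN/sD` gives
`‖U'(ξ' − ξ)‖ ≤ s·ρS/SC` (needs `0 ≤ ρS`, `0 < sD`). [bookkeeping over `norm_apply_le_sqrt_of_entry_box`] -/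
theorem norm_apply_sub_le_of_sharp {sN sD : ℤ} {c₀ w₀ c w : (Fin 3 × Fin 3) ⊕ Fin 3 → ℤ} {ρS : ℤ}
    (h : xiCollarSharpOK sN sD c₀ w₀ ρS c w = true) (hsD : 0 < sD) (hρS : (0 : ℝ) ≤ ρS) (hsN0 : (0 : ℝ) ≤ sN) {U' : E3 →L[ℝ] E3} {ξ' ξ : E3}
    (hbox : ∀ ab : Fin 3 × Fin 3, |(U' (EuclideanSpace.single ab.2 (1 : ℝ))) ab.1 - (c (Sum.inl ab) : ℝ) / SC| ≤ (w (Sum.inl ab) : ℝ) / SC)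
    (hδ : ∀ i : Fin 3, |(ξ' - ξ) i| ≤ ((xiDelta c₀ w₀ c w i : ℤ) : ℝ) / SC) :
    ‖U' (ξ' - ξ)‖ ≤ (sN : ℝ) / sD * ((ρS : ℝ) / SC) := by
  have hS : (0 : ℝ) < SC := SC_pos
  have hD : (0 : ℝ) < sD := by exact_mod_cast hsD
  obtain ⟨-, hbud⟩ := xiCollarSharpOK_spec h
  have hM : ∀ a b : Fin 3, |(U' (EuclideanSpace.single b (1 : ℝ))) a| ≤ ((entryMag c w a b : ℤ) : ℝ) / SC := fun a b =>
    abs_le_of_entry_box (hbox (a, b))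
  have h1 := norm_apply_le_sqrt_of_entry_box hM hδ
  set X : ℝ := ∑ a : Fin 3, (∑ b : Fin 3, ((entryMag c w a b : ℤ) : ℝ) * ((xiDelta c₀ w₀ c w b : ℤ) : ℝ)) ^ 2 with hX
  have hX0 : 0 ≤ X := by rw [hX]; positivity
  have heq : ∑ a : Fin 3, (∑ b : Fin 3, ((entryMag c w a b : ℤ) : ℝ) / SC * (((xiDelta c₀ w₀ c w b : ℤ) : ℝ) / SC)) ^ 2 = X / SC ^ 4 := by
    rw [hX, Finset.sum_div]
    refine Finset.sum_congr rfl fun a _ => ?_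
    have : ∑ b : Fin 3, ((entryMag c w a b : ℤ) : ℝ) / SC * (((xiDelta c₀ w₀ c w b : ℤ) : ℝ) / SC) =
        (∑ b : Fin 3, ((entryMag c w a b : ℤ) : ℝ) * ((xiDelta c₀ w₀ c w b : ℤ) : ℝ)) / SC ^ 2 := by
      rw [Finset.sum_div]; exact Finset.sum_congr rfl fun b _ => by ring
    rw [this, div_pow]; ring
  rw [heq] at h1
  -- `sD²·X ≤ sN²·ρS²·SC²` ⟹ `sD·√X ≤ sN·ρS·SC`
  have hsq : ((sD : ℝ) * Real.sqrt X) ^ 2 ≤ ((sN : ℝ) * ρS * SC) ^ 2 := by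
    rw [mul_pow, Real.sq_sqrt hX0]; nlinarith [hbud]
  have h2 : (sD : ℝ) * Real.sqrt X ≤ (sN : ℝ) * ρS * SC := (abs_le_of_sq_le_sq' hsq (by positivity)).2
  have h3 : Real.sqrt (X / SC ^ 4) = Real.sqrt X / SC ^ 2 := by
    rw [Real.sqrt_div hX0, show ((SC : ℝ)) ^ 4 = (SC ^ 2) ^ 2 by ring, Real.sqrt_sq (by positivity)]
  rw [h3] at h1
  refine h1.trans ?_
  rw [div_mul_div_comm, div_le_div_iff₀ (by positivity) (mul_pos hD hS)]
  -- `√X · (sD·SC) ≤ sN·ρS·SC²`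
  nlinarith [h2, hS]

/-- ★ **EITHER COLLAR ⟹ the dilated collar bound** for the actual `(U', ξ')` (window `‖U' − 1‖ ≤ 1/4` used only on the first branch).
[case split over the two landed bounds] -/
theorem norm_apply_sub_le_of_either {sN sD : ℤ} {c₀ w₀ c w : (Fin 3 × Fin 3) ⊕ Fin 3 → ℤ} {ρS : ℤ}
    (h : xiCollarEitherOK sN sD c₀ w₀ ρS c w = true) (hsD : 0 < sD) (hsDN : sD ≤ sN) (hρS : (0 : ℝ) ≤ ρS) {U' : E3 →L[ℝ] E3} {ξ' ξ : E3}
    (hU' : ‖U' - 1‖ ≤ 1 / 4)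
    (hbox : ∀ ab : Fin 3 × Fin 3, |(U' (EuclideanSpace.single ab.2 (1 : ℝ))) ab.1 - (c (Sum.inl ab) : ℝ) / SC| ≤ (w (Sum.inl ab) : ℝ) / SC)
    (hδ : ∀ i : Fin 3, |(ξ' - ξ) i| ≤ ((xiDelta c₀ w₀ c w i : ℤ) : ℝ) / SC) :
    ‖U' (ξ' - ξ)‖ ≤ (sN : ℝ) / sD * ((ρS : ℝ) / SC) := by
  have hS : (0 : ℝ) < SC := SC_pos
  have hD : (0 : ℝ) < sD := by exact_mod_cast hsD
  have hN : (0 : ℝ) < sN := by exact_mod_cast (lt_of_lt_of_le hsD hsDN)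
  simp only [xiCollarEitherOK, Bool.or_eq_true] at h
  rcases h with hold | hsharp
  · -- the window branch of #25/#26: `‖U'δ‖ ≤ (5/4)·‖Δ‖/SC ≤ s·ρS/SC`
    obtain ⟨-, hbud⟩ := xiConeCollarOK_spec hold
    set m : ℝ := Real.sqrt (∑ i : Fin 3, ((xiDelta c₀ w₀ c w i : ℤ) : ℝ) ^ 2) / SC with hm
    have hsum0 : 0 ≤ ∑ i : Fin 3, ((xiDelta c₀ w₀ c w i : ℤ) : ℝ) ^ 2 := Finset.sum_nonneg fun i _ => sq_nonneg _
    have hm0 : 0 ≤ m := div_nonneg (Real.sqrt_nonneg _) hS.le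
    have hnear' : ∑ i, ((ξ' - ξ) i) ^ 2 ≤ m ^ 2 := by
      rw [hm, div_pow, Real.sq_sqrt hsum0, Finset.sum_div]
      refine Finset.sum_le_sum fun i _ => ?_
      obtain ⟨hl, hr⟩ := abs_le.1 (hδ i)
      rw [← div_pow]
      exact sq_le_sq' hl hr
    have h1 : ‖U' (ξ' - ξ)‖ ≤ (1 + 1 / 4) * m := norm_apply_le_of_coord_sq hU' hm0 hnear'
    have hsq : ((5 / 4 : ℝ) * Real.sqrt (∑ i : Fin 3, ((xiDelta c₀ w₀ c w i : ℤ) : ℝ) ^ 2) * sD) ^ 2 ≤ ((sN : ℝ) * ρS) ^ 2 := by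
      rw [mul_pow, mul_pow, Real.sq_sqrt hsum0]; nlinarith [hbud]
    have h54 : (5 / 4 : ℝ) * Real.sqrt (∑ i : Fin 3, ((xiDelta c₀ w₀ c w i : ℤ) : ℝ) ^ 2) * sD ≤ (sN : ℝ) * ρS :=
      (abs_le_of_sq_le_sq' hsq (mul_nonneg hN.le hρS)).2
    have h2 : (1 + 1 / 4) * m ≤ (sN : ℝ) / sD * ((ρS : ℝ) / SC) := by
      rw [hm, div_mul_div_comm, le_div_iff₀ (mul_pos hD hS)]
      calc (1 + 1 / 4) * (Real.sqrt (∑ i : Fin 3, ((xiDelta c₀ w₀ c w i : ℤ) : ℝ) ^ 2) / SC) * (sD * SC)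
          = (5 / 4 : ℝ) * Real.sqrt (∑ i : Fin 3, ((xiDelta c₀ w₀ c w i : ℤ) : ℝ) ^ 2) * sD := by field_simp; ring
        _ ≤ (sN : ℝ) * ρS := h54
    exact h1.trans h2
  · exact norm_apply_sub_le_of_sharp hsharp hsD hρS hN.le hbox hδ

/-- ★★ **CONE CELL, SHARP EDITION ⟹ hcp leaf goal** at every admissible `(U', ξ')` of the cell, every level. [bookkeeping over `fitOKHDCRSρ_sound` +
`hcpLeafGoal_of_cone_collar`; the collar by `norm_apply_sub_le_of_either`] -/
theorem hcpLeafGoal_of_coneCellSharpOK {c₀ w₀ c w : (Fin 3 × Fin 3) ⊕ Fin 3 → ℤ} {q : Fin 4 → ℤ} {ρS e0S sN sD : ℤ}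
    (hcell : coneCellSharpOK c₀ w₀ ρS (dEnclH c₀ w₀).hi sN sD c w = true) (hfit : fitOKHDCRSρ c₀ w₀ q ρS e0S = true)
    (U' : E3 →L[ℝ] E3) (ξ' : E3) (hsa : ∀ v v' : E3, ⟪U' v, v'⟫ = ⟪v, U' v'⟫) (hU' : ‖U' - 1‖ ≤ 1 / 4) (hξ' : ‖ξ'‖ ≤ 1 / 4)
    (hbox : ∀ ab : Fin 3 × Fin 3, |(U' (EuclideanSpace.single ab.2 (1 : ℝ))) ab.1 - (c (Sum.inl ab) : ℝ) / SC| ≤ (w (Sum.inl ab) : ℝ) / SC)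
    (hξb : ∀ i : Fin 3, |ξ' i - (c (Sum.inr i) : ℝ) / SC| ≤ (w (Sum.inr i) : ℝ) / SC) (μ : ℤ) : HcpLeafGoal μ U' ξ' := by
  simp only [coneCellSharpOK, Bool.and_eq_true] at hcell
  obtain ⟨⟨hdil, hUc⟩, hcol⟩ := hcell
  obtain ⟨hsD, hsDN, hrange⟩ := coneDilationOK_spec hdil
  have hw₀ : ∀ i : Fin 3, (0 : ℤ) ≤ w₀ (Sum.inr i) := by
    simp only [xiCollarEitherOK, Bool.or_eq_true] at hcol
    rcases hcol with h | h
    · exact (xiConeCollarOK_spec h).1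
    · exact (xiCollarSharpOK_spec h).1
  have hS : (0 : ℝ) < SC := SC_pos
  have hsN : 0 < sN := lt_of_lt_of_le hsD hsDN
  have hD : (0 : ℝ) < sD := by exact_mod_cast hsD
  have hN : (0 : ℝ) < sN := by exact_mod_cast hsN
  have hDN : (sD : ℝ) ≤ sN := by exact_mod_cast hsDN
  set s : ℝ := (sN : ℝ) / sD with hs_def
  have hs1 : 1 ≤ s := by rw [hs_def, le_div_iff₀ hD, one_mul]; exact hDN
  have hs0 : 0 < s := by linarith
  have hsinv : s⁻¹ = (sD : ℝ) / sN := by rw [hs_def, inv_div]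
  set U : E3 →L[ℝ] E3 := s⁻¹ • U' with hU_def
  have hUU : s • U = U' := by rw [hU_def, smul_smul, mul_inv_cancel₀ hs0.ne', one_smul]
  have hsaU : ∀ v v' : E3, ⟪U v, v'⟫ = ⟪v, U v'⟫ := selfAdjoint_smul hsa s⁻¹
  have hbox₀ : ∀ ab : Fin 3 × Fin 3,
      |(U (EuclideanSpace.single ab.2 (1 : ℝ))) ab.1 - (c₀ (Sum.inl ab) : ℝ) / SC| ≤ (w₀ (Sum.inl ab) : ℝ) / SC := fun ab => by
    rw [hU_def, smul_entry, hsinv]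
    exact abs_le_of_coneContained hsD hsN (hbox ab) (uConeContained_spec hUc ab).1 (uConeContained_spec hUc ab).2
  obtain ⟨ξ, hξT, hδ⟩ := exists_clamp_near_coord hw₀ hξb
  obtain ⟨-, R, hR⟩ := fitOKHDCRSρ_sound hfit U ξ hsaU hbox₀ hξT
  have hR' : HcpFitCoreRobust U ξ R (4999 / 100000) (((dEnclH c₀ w₀).lo : ℝ) / SC) (((dEnclH c₀ w₀).hi : ℝ) / SC) ((ρS : ℝ) / SC)
      ((e0S : ℝ) / SC) := hR
  have hρS0 : (0 : ℝ) ≤ ρS := by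
    have h0 : (0 : ℝ) ≤ (ρS : ℝ) / SC := hR'.hρ0
    have h1 : (0 : ℝ) ≤ (ρS : ℝ) / SC * SC := mul_nonneg h0 hS.le
    rwa [div_mul_cancel₀ _ (ne_of_gt hS)] at h1
  have hdhi' : s * ((((dEnclH c₀ w₀).hi : ℤ) : ℝ) / SC + (ρS : ℝ) / SC) ≤ 3 / 2 := by
    have hr : (2 : ℝ) * sN * ((((dEnclH c₀ w₀).hi : ℤ) : ℝ) + ρS) ≤ 3 * SC * sD := by exact_mod_cast hrange
    rw [hs_def, ← add_div, div_mul_div_comm, div_le_iff₀ (mul_pos hD hS)]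
    linarith
  have hρ' : ‖(s • U) (ξ' - ξ)‖ ≤ s * ((ρS : ℝ) / SC) := by
    rw [hUU, hs_def]
    exact norm_apply_sub_le_of_either hcol hsD hsDN hρS0 hU' hbox hδ
  have hU'w : ‖s • U - 1‖ ≤ 1 / 4 := by rw [hUU]; exact hU'
  have hξ'2 : ‖ξ'‖ ≤ 1 / 2 := hξ'.trans (by norm_num)
  have := hcpLeafGoal_of_cone_collar hR' hs1 hdhi' hρ' hU'w hξ'2 μ
  rwa [hUU] at this

/-- ★★ **FAT CELL, SHARP EDITION ⟹ hcp leaf goal** (`s = 1`; NO dilation test — the certificate's own `d_hi + ρ ≤ 3/2` is used by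
`hcpLeafGoal_of_collar`). [bookkeeping over `fitOKHDCRSρ_sound` + `hcpLeafGoal_of_collar`] -/
theorem hcpLeafGoal_of_fatCellSharpOK {c₀ w₀ c w : (Fin 3 × Fin 3) ⊕ Fin 3 → ℤ} {q : Fin 4 → ℤ} {ρS e0S : ℤ}
    (hcell : fatCellSharpOK c₀ w₀ ρS c w = true) (hfit : fitOKHDCRSρ c₀ w₀ q ρS e0S = true)
    (U' : E3 →L[ℝ] E3) (ξ' : E3) (hsa : ∀ v v' : E3, ⟪U' v, v'⟫ = ⟪v, U' v'⟫) (hU' : ‖U' - 1‖ ≤ 1 / 4) (hξ' : ‖ξ'‖ ≤ 1 / 4)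
    (hbox : ∀ ab : Fin 3 × Fin 3, |(U' (EuclideanSpace.single ab.2 (1 : ℝ))) ab.1 - (c (Sum.inl ab) : ℝ) / SC| ≤ (w (Sum.inl ab) : ℝ) / SC)
    (hξb : ∀ i : Fin 3, |ξ' i - (c (Sum.inr i) : ℝ) / SC| ≤ (w (Sum.inr i) : ℝ) / SC) (μ : ℤ) : HcpLeafGoal μ U' ξ' := by
  simp only [fatCellSharpOK, Bool.and_eq_true] at hcell
  obtain ⟨hUc, hcol⟩ := hcell
  have hw₀ : ∀ i : Fin 3, (0 : ℤ) ≤ w₀ (Sum.inr i) := by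
    simp only [xiCollarEitherOK, Bool.or_eq_true] at hcol
    rcases hcol with h | h
    · exact (xiConeCollarOK_spec h).1
    · exact (xiCollarSharpOK_spec h).1
  have hS : (0 : ℝ) < SC := SC_pos
  have hbox₀ : ∀ ab : Fin 3 × Fin 3,
      |(U' (EuclideanSpace.single ab.2 (1 : ℝ))) ab.1 - (c₀ (Sum.inl ab) : ℝ) / SC| ≤ (w₀ (Sum.inl ab) : ℝ) / SC := fun ab =>
    abs_le_of_contained (hbox ab) (uContained_spec hUc ab).1 (uContained_spec hUc ab).2
  set T : Set E3 := {ξ | ∀ i : Fin 3, |ξ i - (c₀ (Sum.inr i) : ℝ) / SC| ≤ (w₀ (Sum.inr i) : ℝ) / SC} with hT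
  have hcert : ∀ ξ ∈ T, ∃ (R : E3 →ₗᵢ[ℝ] E3) (η' dlo dhi e₀ : ℝ), HcpFitCoreRobust U' ξ R η' dlo dhi ((ρS : ℝ) / SC) e₀ := by
    intro ξ hξT
    obtain ⟨-, R, hR⟩ := fitOKHDCRSρ_sound hfit U' ξ hsa hbox₀ hξT
    exact ⟨R, 4999 / 100000, ((dEnclH c₀ w₀).lo : ℝ) / SC, ((dEnclH c₀ w₀).hi : ℝ) / SC, (e0S : ℝ) / SC, hR⟩
  obtain ⟨ξ, hξT, hδ⟩ := exists_clamp_near_coord hw₀ hξb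
  have hρS0 : (0 : ℝ) ≤ ρS := by
    obtain ⟨R, η', dlo, dhi, e₀, hR⟩ := hcert ξ hξT
    have h0 : (0 : ℝ) ≤ (ρS : ℝ) / SC := hR.hρ0
    have h1 : (0 : ℝ) ≤ (ρS : ℝ) / SC * SC := mul_nonneg h0 hS.le
    rwa [div_mul_cancel₀ _ (ne_of_gt hS)] at h1
  have hnear : ‖U' (ξ' - ξ)‖ ≤ (ρS : ℝ) / SC := by
    have := norm_apply_sub_le_of_either hcol zero_lt_one le_rfl hρS0 hU' hbox hδ
    simpa using this
  have hξ'2 : ‖ξ'‖ ≤ 1 / 2 := hξ'.trans (by norm_num)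
  exact hcpLeafGoal_of_collar hcert ⟨ξ, hξT, hnear⟩ hU' hξ'2 μ

/-- ★★ **SOUNDNESS IN THE QUOTIENT CURRENCY (cone, sharp)**. [formal bookkeeping] -/
theorem semOKHQ_of_coneLeafSharpOK {μ : ℤ} {c₀ w₀ c w : (Fin 3 × Fin 3) ⊕ Fin 3 → ℤ} {q : Fin 4 → ℤ} {ρS e0S sN sD : ℤ}
    (h : coneLeafSharpOK c₀ w₀ q ρS e0S sN sD c w = true) : semOKHQ μ c w = true :=
  semOKHQ_of_sound (coneLeafSharpOK c₀ w₀ q ρS e0S sN sD)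
    (fun _ _ hv U ξ hsa _ hU hξ hbox hξb _ _ => by
      simp only [coneLeafSharpOK, Bool.and_eq_true] at hv
      exact hcpLeafGoal_of_coneCellSharpOK hv.1 hv.2 U ξ hsa hU hξ hbox hξb μ) h

/-- ★★ **SOUNDNESS IN THE QUOTIENT CURRENCY (fat, sharp)**. [formal bookkeeping] -/
theorem semOKHQ_of_fatLeafSharpOK {μ : ℤ} {c₀ w₀ c w : (Fin 3 × Fin 3) ⊕ Fin 3 → ℤ} {q : Fin 4 → ℤ} {ρS e0S : ℤ}
    (h : fatLeafSharpOK c₀ w₀ q ρS e0S c w = true) : semOKHQ μ c w = true :=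
  semOKHQ_of_sound (fatLeafSharpOK c₀ w₀ q ρS e0S)
    (fun _ _ hv U ξ hsa _ hU hξ hbox hξb _ _ => by
      simp only [fatLeafSharpOK, Bool.and_eq_true] at hv
      exact hcpLeafGoal_of_fatCellSharpOK hv.1 hv.2 U ξ hsa hU hξ hbox hξb μ) h

/-- ★★ **A LIST OF SHARP FAT CELLS OVER ONE THIN CERTIFICATE** ⟹ `semOKHQ` facts at every level. [formal bookkeeping] -/
theorem semFactsQ_of_fatLeavesSharpOK {μ : ℤ} {c₀ w₀ : (Fin 3 × Fin 3) ⊕ Fin 3 → ℤ} {q : Fin 4 → ℤ} {ρS e0S : ℤ}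
    {L : List (((Fin 3 × Fin 3) ⊕ Fin 3 → ℤ) × ((Fin 3 × Fin 3) ⊕ Fin 3 → ℤ))}
    (h : fatLeavesSharpOK c₀ w₀ q ρS e0S L = true) : ∀ b ∈ L, semOKHQ μ b.1 b.2 = true := by
  simp only [fatLeavesSharpOK, Bool.and_eq_true] at h
  intro b hb
  refine semOKHQ_of_fatLeafSharpOK (q := q) (e0S := e0S) (c₀ := c₀) (w₀ := w₀) (ρS := ρS) ?_
  simp only [fatLeafSharpOK, Bool.and_eq_true]
  exact ⟨List.all_eq_true.1 h.2 b hb, h.1⟩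

/-- ★★ **A LIST OF SHARP CONE CELLS OVER ONE THIN CERTIFICATE** ⟹ `semOKHQ` facts on the `(c, w)` of every listed `(sN, sD, c, w)`, every level.
[formal bookkeeping] -/
theorem semFactsQ_of_coneLeavesSharpOK {μ : ℤ} {c₀ w₀ : (Fin 3 × Fin 3) ⊕ Fin 3 → ℤ} {q : Fin 4 → ℤ} {ρS e0S : ℤ}
    {L : List (ℤ × ℤ × ((Fin 3 × Fin 3) ⊕ Fin 3 → ℤ) × ((Fin 3 × Fin 3) ⊕ Fin 3 → ℤ))}
    (h : coneLeavesSharpOK c₀ w₀ q ρS e0S L = true) : ∀ b ∈ L, semOKHQ μ b.2.2.1 b.2.2.2 = true := by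
  simp only [coneLeavesSharpOK, Bool.and_eq_true] at h
  intro b hb
  refine semOKHQ_of_coneLeafSharpOK (q := q) (e0S := e0S) (c₀ := c₀) (w₀ := w₀) (ρS := ρS) (sN := b.1) (sD := b.2.1) ?_
  simp only [coneLeafSharpOK, Bool.and_eq_true]
  exact ⟨List.all_eq_true.1 h.2 b hb, h.1⟩

/-- The same list read on the `(c, w)` projections (the `…HomCutTreeFacts.facts_of_all_sound` shape). [formal bookkeeping] -/
theorem semFactsQ_of_coneLeavesSharpOK_map {μ : ℤ} {c₀ w₀ : (Fin 3 × Fin 3) ⊕ Fin 3 → ℤ} {q : Fin 4 → ℤ} {ρS e0S : ℤ}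
    {L : List (ℤ × ℤ × ((Fin 3 × Fin 3) ⊕ Fin 3 → ℤ) × ((Fin 3 × Fin 3) ⊕ Fin 3 → ℤ))}
    (h : coneLeavesSharpOK c₀ w₀ q ρS e0S L = true) : ∀ b ∈ L.map fun b => b.2.2, semOKHQ μ b.1 b.2 = true := by
  intro b hb
  obtain ⟨a, ha, rfl⟩ := List.mem_map.1 hb
  exact semFactsQ_of_coneLeavesSharpOK h a ha

/-! ## §4. Containment: nothing admitted by #25/#26 is lost -/

/-- The old fat cell test implies the sharp fat cell test. [formal bookkeeping] -/
theorem fatCellSharpOK_of_fatCellOK {c₀ w₀ c w : (Fin 3 × Fin 3) ⊕ Fin 3 → ℤ} {ρS : ℤ} (h : fatCellOK c₀ w₀ ρS c w = true) :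
    fatCellSharpOK c₀ w₀ ρS c w = true := by
  simp only [fatCellOK, Bool.and_eq_true] at h
  simp only [fatCellSharpOK, xiCollarEitherOK, xiConeCollarOK_one_one, Bool.and_eq_true, Bool.or_eq_true]
  exact ⟨h.1, Or.inl h.2⟩

/-- The old cone cell test implies the sharp cone cell test. [formal bookkeeping] -/
theorem coneCellSharpOK_of_coneCellOK {c₀ w₀ c w : (Fin 3 × Fin 3) ⊕ Fin 3 → ℤ} {ρS hi sN sD : ℤ}
    (h : coneCellOK c₀ w₀ ρS hi sN sD c w = true) : coneCellSharpOK c₀ w₀ ρS hi sN sD c w = true := by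
  simp only [coneCellOK, Bool.and_eq_true] at h
  simp only [coneCellSharpOK, xiCollarEitherOK, Bool.and_eq_true, Bool.or_eq_true]
  exact ⟨⟨h.1.1, h.1.2⟩, Or.inl h.2⟩

end Summit.AtomisticToContinuum.Crystallization.Theorems.FrustratedLawDichotomyStrainedPatchHomEntryFitHcpSharpCollar

end
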